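import Summits.CriticalPhenomena.PercolationContinuityZ3.Theorems.Transplant.PlanarSkeletonFrmQuasiDefs
import Summits.CriticalPhenomena.PercolationContinuityZ3.Theorems.Transplant.SkelFrmQuasiBChoiceCreep2
import Summits.CriticalPhenomena.PercolationContinuityZ3.Theorems.Transplant.SkelFrmBChoiceCreep2
import Summits.CriticalPhenomena.PercolationContinuityZ3.Theorems.Transplant.SkelFrmQuasiBChoiceCellsV
import Summits.CriticalPhenomena.PercolationContinuityZ3.Theorems.Transplant.SkelFrmBChoiceCellsV
import Summits.CriticalPhenomena.PercolationContinuityZ3.Theorems.Transplant.SkelFrmQuasi1ChoiceDefs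
import Summits.CriticalPhenomena.PercolationContinuityZ3.Theorems.Transplant.SkelFrmQuasiBChoiceCreepY3
import Summits.CriticalPhenomena.PercolationContinuityZ3.Theorems.Transplant.SkelFrmQuasiBChoiceDefs
import Summits.CriticalPhenomena.PercolationContinuityZ3.Theorems.Transplant.SkelFrmQuasiBParamsCorrKG
import Summits.CriticalPhenomena.PercolationContinuityZ3.Theorems.Transplant.SkelFrmQuasiBParamsCorrKGLen3
import Summits.CriticalPhenomena.PercolationContinuityZ3.Theorems.Transplant.SkelFrmQuasiBParamsLF
import Summits.CriticalPhenomena.PercolationContinuityZ3.Theorems.Transplant.SkelFrmQuasiBParamsLFA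
import Summits.CriticalPhenomena.PercolationContinuityZ3.Theorems.Transplant.SkelFrmQuasi1SlotTypes
import Summits.CriticalPhenomena.PercolationContinuityZ3.Theorems.Transplant.SkelFrmQuasiBChoiceNums
import HarnessLib
import Summits.CriticalPhenomena.PercolationContinuityZ3.Theorems.Transplant.SkelFrmBChoiceRoomV
/-!
# GEN-Q PORT (WAVE-Q table v0.8 section 2, row G161, U-level L?; captain R-6/R-7 2026-08-27: carrier token swap `PlanarSkeletonFrmFrom ↦ PlanarSkeletonFrmQuasi`)
# of the tree module «Transplant/SkelFrmFromBChoiceRoomV» (sha256 deabd1d4ee3d9453…) onto the quasi-step carrier `PlanarSkeletonFrmQuasi` (p507026): «SkelFrmQuasiBChoiceRoomV»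

ORIGINAL TITLE: N2 (frames-only node `SamePDropOfSkeletonFrm₁`, OPEN) — (ζ″) under (R-44)/(R-45): THE FORWARD-ROOM SLOT VALUE OF RECORD **`NegB.hFR mk : CSlot`**,

builds on p205010 (kernel theorem, internal audit signed; external expert review pending) — nothing in this file uses p205010; NOTHING is claimed about any open node
((N3-b), the end state).  Lane `prim-bschramm`, seat `prim-bschramm-gen-1` (gen 5; WAVE-Q captain).  Helper file (`--supports stmt-CriticalPhenomena-4575 --as helper`).
PORT RULES (U-wave r1–r4 re-used, GEN-Q hunk classes of p3-g29 #6136): declaration order, names and proof texts are those of «SkelFrmFromBChoiceRoomV», byte-identical except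
(i) the carrier token `PlanarSkeletonFrmFrom ↦ PlanarSkeletonFrmQuasi` in binders, `namespace`/`end` lines and qualified names (module names `SkelFrmFrom… ↦ SkelFrmQuasi…`
in imports of already-ported rows); (ii) `Φ.step ↦ Φ.qstep` with the called Steps lemma replaced by its `…Q`/`_q` twin and the cost `Φ.M` threaded (none in this file unless
listed below); (iii) `Φ.cyl_connected ↦ Φ.cyl_reach` readers (none unless listed); (iv) graph-ball radii / window floors ×`Φ.M` (none unless listed); (v) KS0 READER HUNK of record (L-KitS-1 / L-FLOORMAP-1 ①, stmt-g33's table #6324, tool T6): the (S0) kit data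
of «SkelFrmQuasiBChoiceNums» (G017) are N-parametrised and read at `N := KS.NQ Φ = 13·max Φ.M 1` — IN THIS FILE KS0.R'0N ×2 (e.g. `KS0.R'0 κ Φ … ↦ KS0.R'0N κ Φ (KS.NQ Φ) …`), nothing else.  Carrier-free
residents stay imported/exported from the original «SkelFrmBChoiceRoomV» exactly as in the FrmFrom port.  Docstrings and citations are the original's.
Row G161 (gen-1 g5).
-/

open scoped Classical

noncomputable section

namespace Summit.CriticalPhenomena.PercolationContinuityZ3.Theorems.Transplant

namespace PlanarSkeletonFrmQuasi

export PlanarSkeletonNeg.Neg (K K_eq Kq cells)  -- T3-auto: resident alias(es) replicated from the FrmFrom namespace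

namespace NegB

open Literature.Probability.Percolation Literature.Probability.LatticeModels SimpleGraph KNCells
open Literature.Probability.Percolation.KozmaNitzan.Cells (oth oth_oth)
open SkelConc (Consts)
open Neg

export PlanarSkeletonFrm.NegB (HF)

export PlanarSkeletonFrm.NegB (HK)

export PlanarSkeletonFrm.NegB (HF_apply)

section Room

variable (κ : Consts) {V : Type} [DecidableEq V] [Countable V] {G : SimpleGraph V} [G.LocallyFinite] (Φ : PlanarSkeletonFrmQuasi G) (t : V) (p : unitInterval)
  (D : Skelφ.StepI.DataNS V) (g f mk : ℕ)

/-- **The forward-room value** `hFRv mk I := cR2vW mk I + HF I · s (oth I) + HK I` (fine cells; the step along `I` is felt on `oth I`). [this work] -/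
def hFRv (κ : Consts) {V : Type} [DecidableEq V] [Countable V] {G : SimpleGraph V} [G.LocallyFinite] (Φ : PlanarSkeletonFrmQuasi G) (t : V) (p : unitInterval) (D : Skelφ.StepI.DataNS V) (g : ℕ) (f : ℕ) (mk : ℕ) : Fin 2 → ℕ := fun I => cR2vW κ Φ t p D g f mk I + HF I * (fcellsA κ Φ t p D g f).s (oth I) + HK I

/-- `hFRv 0 = cRvW 0 + 5·s₁ + 2`, `hFRv 1 = cRvY3 + 54·s₀ + 2`. [folklore] -/
theorem hFRv_apply (κ : Consts) {V : Type} [DecidableEq V] [Countable V] {G : SimpleGraph V} [G.LocallyFinite] (Φ : PlanarSkeletonFrmQuasi G) (t : V) (p : unitInterval) (D : Skelφ.StepI.DataNS V) (g : ℕ) (f : ℕ) (mk : ℕ) : hFRv κ Φ t p D g f mk 0 = cRvW κ Φ t p D g f mk 0 + 5 * (fcellsA κ Φ t p D g f).s 1 + 2 ∧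
    hFRv κ Φ t p D g f mk 1 = cRvY3 κ Φ t p D g f mk + 54 * (fcellsA κ Φ t p D g f).s 0 + 2 := by
  refine ⟨?_, ?_⟩
  · simp only [hFRv, (cR2vW_apply κ Φ t p D g f mk).1, HF_apply.1, HF_apply.2.2.1, show oth (0 : Fin 2) = 1 by decide]
  · simp only [hFRv, (cR2vW_apply κ Φ t p D g f mk).2, HF_apply.2.1, HF_apply.2.2.2, show oth (1 : Fin 2) = 0 by decide]

/-- **The forward room fits twice the opposite half-side** (`K ≥ 200`): `hFRv I ≤ 2·r (oth I)` — so `hFV (hFRv …) = hFRv` (the truncation is inactive). [this work] -/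
theorem hFRv_le_two_r (κ : Consts) {V : Type} [DecidableEq V] [Countable V] {G : SimpleGraph V} [G.LocallyFinite] (Φ : PlanarSkeletonFrmQuasi G) (t : V) (p : unitInterval) (D : Skelφ.StepI.DataNS V) (g : ℕ) (f : ℕ) (mk : ℕ) (hKq : 5 ≤ Neg.Kq κ) (hN : EqNumL κ Φ t p D g f) (hg : gFloorKG κ Φ t p D mk ≤ g) (hg2 : 40 * Neg.K κ * KS0.R'0N κ Φ (KS.NQ Φ) t p D mk ≤ g) :
    ∀ I, hFRv κ Φ t p D g f mk I ≤ 2 * (fcellsA κ Φ t p D g f).r (oth I) := by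
  have hK200 : 200 ≤ Neg.K κ := by have := Neg.K_eq κ; omega
  have hr : ∀ i, (((fcellsA κ Φ t p D g f).r i : ℕ) : ℤ) = (Neg.K κ : ℤ) * (((fcellsA κ Φ t p D g f).s i : ℕ) : ℤ) := fun i => by
    rw [PCells2.r_eq, show ((fcellsA κ Φ t p D g f).K : ℤ) = Neg.K κ by exact_mod_cast (fcellsA_K κ Φ t p D g f).1]
  have hK' : (200 : ℤ) ≤ Neg.K κ := by exact_mod_cast hK200
  intro I
  fin_cases I
  · -- x-steps: cRvW 0 ≤ 27·s₁ + 1, + 5·s₁ + 2 ≤ 2K·s₁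
    show hFRv κ Φ t p D g f mk 0 ≤ 2 * (fcellsA κ Φ t p D g f).r (oth 0)
    rw [(hFRv_apply κ Φ t p D g f mk).1, show oth (0 : Fin 2) = 1 by decide]
    obtain ⟨-, hhi, -, -, hle⟩ := rd1_bounds_W κ Φ t p D g f mk hN hg hg2
    obtain ⟨hc, -⟩ := cRvW_zero_eq κ Φ t p D g f mk hN hg hg2
    have hs1 : (1 : ℤ) ≤ (((fcellsA κ Φ t p D g f).s 1 : ℕ) : ℤ) := by exact_mod_cast (fcellsA κ Φ t p D g f).hs 1
    have hKs : 200 * (((fcellsA κ Φ t p D g f).s 1 : ℕ) : ℤ) ≤ (Neg.K κ : ℤ) * (((fcellsA κ Φ t p D g f).s 1 : ℕ) : ℤ) :=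
      mul_le_mul_of_nonneg_right hK' (by linarith)
    have key : ((cRvW κ Φ t p D g f mk 0 : ℕ) : ℤ) + 5 * (((fcellsA κ Φ t p D g f).s 1 : ℕ) : ℤ) + 2 ≤ 2 * (((fcellsA κ Φ t p D g f).r 1 : ℕ) : ℤ) := by
      rw [hc, hr 1]; unfold cmidW; omega
    exact_mod_cast key
  · -- y′-steps: cRvY3 ≤ 108·s₀, + 54·s₀ + 2 ≤ 2K·s₀
    show hFRv κ Φ t p D g f mk 1 ≤ 2 * (fcellsA κ Φ t p D g f).r (oth 1)
    rw [(hFRv_apply κ Φ t p D g f mk).2, show oth (1 : Fin 2) = 0 by decide]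
    obtain ⟨-, hc, -⟩ := cRvY3_le κ Φ t p D g f mk hKq hN hg hg2
    have hs0 : (1 : ℤ) ≤ (((fcellsA κ Φ t p D g f).s 0 : ℕ) : ℤ) := by exact_mod_cast (fcellsA κ Φ t p D g f).hs 0
    have hKs : 200 * (((fcellsA κ Φ t p D g f).s 0 : ℕ) : ℤ) ≤ (Neg.K κ : ℤ) * (((fcellsA κ Φ t p D g f).s 0 : ℕ) : ℤ) :=
      mul_le_mul_of_nonneg_right hK' (by linarith)
    have key : ((cRvY3 κ Φ t p D g f mk : ℕ) : ℤ) + 54 * (((fcellsA κ Φ t p D g f).s 0 : ℕ) : ℤ) + 2 ≤ 2 * (((fcellsA κ Φ t p D g f).r 0 : ℕ) : ℤ) := by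
      rw [hr 0]; linarith
    exact_mod_cast key

-- GEN-Q (R-2, captain 2026-08-27): `PlanarSkeletonFrmFrom.NegB.cR2vW_lt_hFRv` is not in the used cone of the node top — not ported.

/-- **The V cells' forward room IS the value** under the floors: `(fcellsV … c (hFRv …)).hF I = hFRv I`. [this work] -/
theorem fcellsV_hF_eq_hFRv (κ : Consts) {V : Type} [DecidableEq V] [Countable V] {G : SimpleGraph V} [G.LocallyFinite] (Φ : PlanarSkeletonFrmQuasi G) (t : V) (p : unitInterval) (D : Skelφ.StepI.DataNS V) (g : ℕ) (f : ℕ) (mk : ℕ) (c : Fin 2 → ℕ) (hKq : 5 ≤ Neg.Kq κ) (hN : EqNumL κ Φ t p D g f) (hg : gFloorKG κ Φ t p D mk ≤ g)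
    (hg2 : 40 * Neg.K κ * KS0.R'0N κ Φ (KS.NQ Φ) t p D mk ≤ g) (I : Fin 2) :
    (fcellsV κ Φ t p D g f c (hFRv κ Φ t p D g f mk)).hF I = hFRv κ Φ t p D g f mk I :=
  fcellsV_hF_eq κ Φ t p D g f c (hFRv κ Φ t p D g f mk) (hFRv_le_two_r κ Φ t p D g f mk hKq hN hg hg2) I

end Room

/-- **THE FORWARD-ROOM SLOT OF RECORD** `hFR mk : CSlot` (same type as the creep slot: the V cells read `fcellsV … (cv …) (hv …)`). [this work] -/
def hFR (mk : ℕ) : CSlot := fun κ _ _ _ _ _ Φ t p D g f => hFRv κ Φ t p D g f mk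

-- GEN-Q (R-2, captain 2026-08-27): `PlanarSkeletonFrmFrom.NegB.hFR_apply` is not in the used cone of the node top — not ported.

end NegB

end PlanarSkeletonFrmQuasi

end Summit.CriticalPhenomena.PercolationContinuityZ3.Theorems.Transplant

end
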